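import Summits.BirchSwinnertonDyer.BirchSwinnertonDyer.Theorems.SignedLowerHalvesSmallImageLowerHalfBothSignsRttCharRoadE1TorsionRestrict
import Literature.NumberTheory.EllipticCurves.SelmerPInftyRestriction
import HarnessLib

/-!
# Route `SignedLowerHalves`, crux L `SmallImageLowerHalfBothSigns` (stmt-BirchSwinnertonDyer-23599), line `rtt_w3` v12 — glue INPUT (I4) of the LEAD's composition
# `injTop_of_inputs` (INPUT SPEC 10:26:53Z): the `k`-structure endomorphism `u` of `W[p]` (p767784 `exists_kStructure_endomorphism_coords`: matrix a trace-zero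
# non-scalar `y ∈ k`; commutes with `ρ̄⁻¹(kˣ)`, anticommutes with the rest) TOGETHER WITH THE BRIDGE to the `K`-side scalars: `û := u_b` for a scalar `b` of
# honda's formal `𝒪_{K_v}`-module (`exists_torsionModule`, p768859) satisfies
# `û (pBCE (ι a)) = pBCE (ι (u a))` for all `a ∈ W[p]` (`pBCE = primaryBaseChangeEquiv K W p`, `ι : W[p] ↪ W[p^∞]`).

Width seat `bsd-line-slh-p3-w3` g18 under LEAD `cruxlead-stmt-BirchSwinnertonDyer-23599` (cell `bsd-ssimc`; `--supports stmt-BirchSwinnertonDyer-23599 --as helper`).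
THEOREMS ONLY (no definition, no named fact, no instance, no `sorry`). INPUTS (all as hypotheses, honda's shapes): the scalars `uK : R → (TK →+ TK)` with pointwise
ring laws, «`Γ_{K_v}` acts through the scalars» `hχ : resGalOfEmb ι δ • x = uK (χ δ) x`, and ONE non-scalar witness `hw` (a `δ₀` with `uK (χ δ₀)` not of the form `n •`
on the `p`-torsion — e.g. `χ δ₀` a unit of residue outside `𝔽_p`, via row J-curve's `α`). Composition: p768916 `exists_torsionRestrict` (restriction to `W_K[p]`),
p768789 `exists_torsionAction_eq_transport` (rigidity: `u_b|_{W_K[p]}` realises `y`), `pBCE ∘ ι = ι_K ∘ tBCE` (`Subtype.ext rfl`). BSD / crux L / INJ_top are NOT proved here.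

* `primaryBaseChangeEquiv_inclusion` — `pBCE (ι a) = ι_K (torsionBaseChangeEquiv K W p a)`.
* ★★★ `exists_kStructure_bridge` — (I4): `∃ y u v b`, the nine conclusions of p767784 for `(y, u, v)` and the bridge for `û := uK b`.

References: [Serre1972] §2.2; [SerreGaloisCohomology1997] I §2.4, II §1.1; [LubinTate1965] §1; [SilvermanAEC2009] III.7.
-/

set_option autoImplicit false
set_option linter.dupNamespace false -- D-0017: single-problem summit, the namespace repeats the problem name by design
noncomputable section

open scoped Classical MatrixGroups

namespace Summit.BirchSwinnertonDyer.BirchSwinnertonDyer.Theorems.SmallImageCharSignedSelmer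

open Literature.NumberTheory.GaloisRepresentations Literature.NumberTheory.GaloisRepresentations.Serre1972
  Literature.NumberTheory.EllipticCurves WeierstrassCurve Matrix

section Bridge

variable {F : Type} [Field F] (L : Type) [Field L] [Algebra F L] [Algebra.IsAlgebraic F L]
  (W : WeierstrassCurve F) {p : ℕ} [Fact p.Prime]

omit [Fact p.Prime] in
/-- `pBCE ∘ (W[p] ↪ W[p^∞]) = (W_L[p] ↪ W_L[p^∞]) ∘ tBCE` (both are the points map along the chosen embedding). [cite: SerreGaloisCohomology1997, II §1.1] -/
theorem primaryBaseChangeEquiv_inclusion (a : geomTorsion W p) :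
    primaryBaseChangeEquiv L W p (AddSubgroup.inclusion (geomTorsion_le_geomPrimaryTorsion W p) a) =
      AddSubgroup.inclusion (geomTorsion_le_geomPrimaryTorsion (W.baseChange L) p) (torsionBaseChangeEquiv L W p a) :=
  Subtype.ext rfl

variable (Φ : Multiplicative (AddAut (geomTorsion W p)) ≃* GL (Fin 2) (ZMod p))
  (k : Subalgebra (ZMod p) (Matrix (Fin 2) (Fin 2) (ZMod p))) (e₀ : geomTorsion W p ≃+ (Fin 2 → ZMod p))
  (he₀ : ∀ (g : Multiplicative (AddAut (geomTorsion W p))) (x : geomTorsion W p),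
    e₀ (Multiplicative.toAdd g x) = ((Φ g : GL (Fin 2) (ZMod p)) : Matrix (Fin 2) (Fin 2) (ZMod p)) *ᵥ e₀ x)

include he₀ in
/-- ★★★ **INPUT (I4): the `k`-structure endomorphism with its bridge to the `K`-side scalars.** Stub datum `(Φ, k, e₀)` (`k` a field of degree `2`, `ρ̄(Γ_F)`
normalising `kˣ`, `ρ̄(Γ_L) ⊆ kˣ`), `p` odd; honda's scalars `uK : R → End(W_L[p^∞])` (`R` commutative, pointwise unital ring action) through which `Γ_{L_w}` acts
(`resGalOfEmb ι δ • x = uK (χ δ) x`), with one `δ₀` for which `uK (χ δ₀)` is not of the form `n •` on the `p`-torsion. Then there are the trace-zero non-scalar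
`y ∈ k`, the endomorphisms `u, v` of `W[p]` of p767784 (all nine clauses), and a scalar `b` with the BRIDGE `uK b (pBCE (ι a)) = pBCE (ι (u a))` for all `a ∈ W[p]`.
[cite: Serre1972, §2.2] [cite: SerreGaloisCohomology1997, I §2.4, II §1.1] [cite: LubinTate1965, §1 Thm. 1] -/
theorem exists_kStructure_bridge (hp : p ≠ 2) (hk : IsField k) (h2 : Module.finrank (ZMod p) k = 2)
    (hGN : (galoisRepTorsion W p).range.map Φ.toMonoidHom ≤ Subgroup.normalizer (unitGroup k : Set (GL (Fin 2) (ZMod p))))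
    (hKU : ∀ τ : Field.absoluteGaloisGroup L, Φ (galoisRepTorsion W p (absGaloisRestrict F L τ)) ∈ unitGroup k)
    {R : Type*} [CommSemiring R] (uK : R → ((W.baseChange L).geomPrimaryTorsion p →+ (W.baseChange L).geomPrimaryTorsion p))
    (hadd : ∀ (a b : R) (x : (W.baseChange L).geomPrimaryTorsion p), uK (a + b) x = uK a x + uK b x)
    (hmul : ∀ (a b : R) (x : (W.baseChange L).geomPrimaryTorsion p), uK (a * b) x = uK a (uK b x))
    (hone : ∀ x : (W.baseChange L).geomPrimaryTorsion p, uK 1 x = x)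
    {E' : Type} [Field E'] [Algebra L E'] (ι : AlgebraicClosure L →ₐ[L] AlgebraicClosure E') (χ : Field.absoluteGaloisGroup E' → R)
    (hχ : ∀ (δ : Field.absoluteGaloisGroup E') (x : (W.baseChange L).geomPrimaryTorsion p), resGalOfEmb ι δ • x = uK (χ δ) x)
    (hw : ∃ δ₀ : Field.absoluteGaloisGroup E', ∀ n : ℕ, ∃ x : (W.baseChange L).geomPrimaryTorsion p, p • x = 0 ∧ uK (χ δ₀) x ≠ n • x) :
    ∃ (y : Matrix (Fin 2) (Fin 2) (ZMod p)) (u v : geomTorsion W p →+ geomTorsion W p) (b : R),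
      y ∈ k ∧ (∀ c : ZMod p, y ≠ c • 1) ∧ y.trace = 0 ∧
      (∀ m : geomTorsion W p, e₀ (u m) = y *ᵥ e₀ m) ∧ (∀ m : geomTorsion W p, e₀ (v m) = y⁻¹ *ᵥ e₀ m) ∧
      (∀ m : geomTorsion W p, v (u m) = m) ∧
      (∀ σ : Field.absoluteGaloisGroup F, Φ (galoisRepTorsion W p σ) ∈ unitGroup k → ∀ m : geomTorsion W p, u (σ • m) = σ • u m) ∧
      (∀ σ : Field.absoluteGaloisGroup F, Φ (galoisRepTorsion W p σ) ∈ unitGroup k → ∀ m : geomTorsion W p, v (σ • m) = σ • v m) ∧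
      (∀ c : Field.absoluteGaloisGroup F, Φ (galoisRepTorsion W p c) ∉ unitGroup k → ∀ m : geomTorsion W p, u (c • m) = -(c • u m)) ∧
      (∀ a : geomTorsion W p,
        uK b (primaryBaseChangeEquiv L W p (AddSubgroup.inclusion (geomTorsion_le_geomPrimaryTorsion W p) a)) =
          primaryBaseChangeEquiv L W p (AddSubgroup.inclusion (geomTorsion_le_geomPrimaryTorsion W p) (u a))) := by
  obtain ⟨y, u, v, hy, hys, htr, hu, hv, hvu, hσu, hσv, hcu⟩ := exists_kStructure_endomorphism_coords W hp Φ k e₀ he₀ hk h2 hGN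
  obtain ⟨u', hu', hadd', hmul', hone', -, hthrough, hwit⟩ := exists_torsionRestrict (W.baseChange L) p uK
  obtain ⟨δ₀, hδ₀⟩ := hw
  -- `τ₀ = res δ₀` acts on `W_L[p]` as the scalar `χ δ₀`, which is non-scalar
  set τ₀ : Field.absoluteGaloisGroup L := resGalOfEmb ι δ₀ with hτ₀def
  have hτ₀act : ∀ Q : geomTorsion (W.baseChange L) p, τ₀ • Q = u' (χ δ₀) Q := hthrough τ₀ (χ δ₀) (fun x ↦ hχ δ₀ x)
  have hwit' : ∀ n : ℕ, ∃ Q : geomTorsion (W.baseChange L) p, u' (χ δ₀) Q ≠ n • Q := fun n ↦ hwit (χ δ₀) n (hδ₀ n)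
  have hτ₀s : ∀ c : ZMod p,
      ((Φ (galoisRepTorsion W p (absGaloisRestrict F L τ₀)) : GL (Fin 2) (ZMod p)) : Matrix (Fin 2) (Fin 2) (ZMod p)) ≠ c • 1 :=
    coords_ne_smul_one_of_forall_exists_ne_nsmul ((torsionBaseChangeEquiv L W p).symm.trans e₀) (fun Q ↦ τ₀ • Q)
      (coords_smul_baseChange L W Φ e₀ he₀ τ₀) (fun n ↦ by
        obtain ⟨Q, hQ⟩ := hwit' n
        exact ⟨Q, by rw [hτ₀act]; exact hQ⟩)
  have hτ₀ : Φ (galoisRepTorsion W p (absGaloisRestrict F L τ₀)) ∈ unitGroup k := hKU τ₀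
  -- the restricted scalars commute with `τ₀` (commutativity of `R`)
  have hcomm : ∀ (r : R) (Q : geomTorsion (W.baseChange L) p), u' r (τ₀ • Q) = τ₀ • u' r Q := fun r Q ↦ by
    rw [hτ₀act, hτ₀act, ← hmul' hmul, mul_comm, hmul' hmul]
  have hr₀ : ∀ c : ZMod p, ∃ Q : geomTorsion (W.baseChange L) p,
      ((torsionBaseChangeEquiv L W p).symm.trans e₀) (u' (χ δ₀) Q) ≠ c • ((torsionBaseChangeEquiv L W p).symm.trans e₀) Q :=
    coords_ne_smul_of_ne_nsmul _ (u' (χ δ₀)) hwit'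
  -- rigidity: `u' b = tBCE ∘ u ∘ tBCE⁻¹` for some `b`
  obtain ⟨b, hb⟩ := exists_torsionAction_eq_transport L W Φ k e₀ he₀ h2 hτ₀ hτ₀s u' (hadd' hadd) (hmul' hmul) (hone' hone) hcomm hr₀ u hy hu
  refine ⟨y, u, v, b, hy, hys, htr, hu, hv, hvu, hσu, hσv, hcu, fun a ↦ ?_⟩
  rw [primaryBaseChangeEquiv_inclusion, primaryBaseChangeEquiv_inclusion, ← hu', hb, AddEquiv.symm_apply_apply]

end Bridge

end Summit.BirchSwinnertonDyer.BirchSwinnertonDyer.Theorems.SmallImageCharSignedSelmer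

end
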